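import Summits.RiemannHypothesis.RiemannHypothesis.Theorems.HandoffDodgerFarTailBound
import HarnessLib

/-!
# HANDOFF — the FAR ZERO-TAIL of the dodger, evaluation layer II: the lower half of the grid (rh-explicit, track «HANDOFF», seat prove-2 gen14, ATTEMPT-24 §1, brick FT part 3)

HONEST FRAMING. Nothing here bears on the truth of RH; this is zero COUNTING (RH-free upper-side bookkeeping of the dodger's far-zone cost). The density
integral `∫ (log(t/2π)/(2π)) e^{−X²/t²}/t² dt` on `[X/4, 3X/2]` (seven pieces `X·{1/4,1/3,1/2,2/3,5/6,1,6/5,3/2}` of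
`integral_farDensity_piece_le`, degree-5 Taylor bounds for `e^{−1/q²}`, `log 2`-based bounds for `log q`), as a linear form in
`log X/(2πX)` and `1/(2πX)` with exact rational coefficients: `integral_farDensity_lower_le`. Generated mechanically from the grid table
(HOME/handoff/prove-2/code/a24/griddata.py). No `sorry`, standard axioms, no definitions.

References: this track (HOME/handoff/prove-2/ATTEMPT-16.md §4 Lemma C3; ATTEMPT-24.md §1). Hasanalizade–Shen–Wong 2022 Cor. 1.2 (tree).
-/

set_option linter.dupNamespace false

noncomputable section

open Real Finset MeasureTheory intervalIntegral Set

namespace Summit.RiemannHypothesis.RiemannHypothesis.Theorems.Handoff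

open Literature.NumberTheory.LFunctions Literature.NumberTheory.LFunctions.SchoenfeldBound
  Literature.NumberTheory.LFunctions.KadiriTail

/-! ## The grid -/

set_option maxHeartbeats 400000 in
/-- The density integral on the lower half of the grid, `[X/4, 3X/2]` (seven pieces). [this track, ATTEMPT-24 §1] -/
theorem integral_farDensity_lower_le {X : ℝ} (hX : Real.exp 8 ≤ X) :
    ∫ t in X * (1 / 4)..X * (3 / 2), Real.log (t / (2 * π)) / (2 * π) * (Real.exp (-X ^ 2 / t ^ 2) / t ^ 2) ≤
      (6204527 / 15000000 : ℝ) * (Real.log X / (2 * π * X)) + (-8449956231 / 12500000000 : ℝ) * (1 / (2 * π * X)) := by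
  have hπ := Real.pi_pos
  have he8 : (2980 : ℝ) ≤ Real.exp 8 := by
    have h : Real.exp 8 = Real.exp 1 ^ 8 := by rw [← Real.exp_nat_mul]; norm_num
    rw [h]
    have := Real.exp_one_gt_d9
    nlinarith [pow_le_pow_left₀ (by norm_num : (0:ℝ) ≤ 2.7182818283) this.le 8]
  have hX0 : 0 < X := by linarith
  have h2π0 : (0:ℝ) < 2 * π := by positivity
  have h2π4 : 2 * π ≤ X * (1 / 4) := by linarith [Real.pi_lt_d6]
  have hL2π := log_two_pi_ge
  -- from `2π ≤ X/4` to `2π ≤ X p`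
  have h2πp : ∀ p : ℝ, 1 / 4 ≤ p → 2 * π ≤ X * p := fun p hp =>
    h2π4.trans (mul_le_mul_of_nonneg_left hp hX0.le)
  have h4p : ∀ p : ℝ, 1 / 4 ≤ p → X * (1 / 4) ≤ X * p := fun p hp => mul_le_mul_of_nonneg_left hp hX0.le
  -- integrability of the density weight on `[X/4, ∞)`
  have hI : ∀ a b : ℝ, X * (1 / 4) ≤ a → X * (1 / 4) ≤ b →
      IntervalIntegrable (fun t : ℝ => Real.log (t / (2 * π)) / (2 * π) * (Real.exp (-X ^ 2 / t ^ 2) / t ^ 2)) volume a b := by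
    intro a b ha hb
    refine ContinuousOn.intervalIntegrable (continuousOn_of_forall_continuousAt fun t ht => ?_)
    have hmin : X * (1 / 4) ≤ min a b := le_min ha hb
    have h1 : min a b ≤ t := ht.1
    have ht0 : 0 < t := by nlinarith
    have : t ≠ 0 := ht0.ne'
    have : t / (2 * π) ≠ 0 := by positivity
    fun_prop (disch := (first | assumption | positivity))
  have hTop : X * (1 / 4) ≤ X * (3/2) := h4p _ (by norm_num)
  have e0 : (∫ t in X * (1/4)..X * (3/2), Real.log (t / (2 * π)) / (2 * π) * (Real.exp (-X ^ 2 / t ^ 2) / t ^ 2)) = (∫ t in X * (1/4)..X * (1/3), Real.log (t / (2 * π)) / (2 * π) * (Real.exp (-X ^ 2 / t ^ 2) / t ^ 2)) + ∫ t in X * (1/3)..X * (3/2), Real.log (t / (2 * π)) / (2 * π) * (Real.exp (-X ^ 2 / t ^ 2) / t ^ 2) :=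
    (intervalIntegral.integral_add_adjacent_intervals (hI _ _ (h4p _ (by norm_num)) (h4p _ (by norm_num)))
      (hI _ _ (h4p _ (by norm_num)) hTop)).symm
  have e1 : (∫ t in X * (1/3)..X * (3/2), Real.log (t / (2 * π)) / (2 * π) * (Real.exp (-X ^ 2 / t ^ 2) / t ^ 2)) = (∫ t in X * (1/3)..X * (1/2), Real.log (t / (2 * π)) / (2 * π) * (Real.exp (-X ^ 2 / t ^ 2) / t ^ 2)) + ∫ t in X * (1/2)..X * (3/2), Real.log (t / (2 * π)) / (2 * π) * (Real.exp (-X ^ 2 / t ^ 2) / t ^ 2) :=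
    (intervalIntegral.integral_add_adjacent_intervals (hI _ _ (h4p _ (by norm_num)) (h4p _ (by norm_num)))
      (hI _ _ (h4p _ (by norm_num)) hTop)).symm
  have e2 : (∫ t in X * (1/2)..X * (3/2), Real.log (t / (2 * π)) / (2 * π) * (Real.exp (-X ^ 2 / t ^ 2) / t ^ 2)) = (∫ t in X * (1/2)..X * (2/3), Real.log (t / (2 * π)) / (2 * π) * (Real.exp (-X ^ 2 / t ^ 2) / t ^ 2)) + ∫ t in X * (2/3)..X * (3/2), Real.log (t / (2 * π)) / (2 * π) * (Real.exp (-X ^ 2 / t ^ 2) / t ^ 2) :=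
    (intervalIntegral.integral_add_adjacent_intervals (hI _ _ (h4p _ (by norm_num)) (h4p _ (by norm_num)))
      (hI _ _ (h4p _ (by norm_num)) hTop)).symm
  have e3 : (∫ t in X * (2/3)..X * (3/2), Real.log (t / (2 * π)) / (2 * π) * (Real.exp (-X ^ 2 / t ^ 2) / t ^ 2)) = (∫ t in X * (2/3)..X * (5/6), Real.log (t / (2 * π)) / (2 * π) * (Real.exp (-X ^ 2 / t ^ 2) / t ^ 2)) + ∫ t in X * (5/6)..X * (3/2), Real.log (t / (2 * π)) / (2 * π) * (Real.exp (-X ^ 2 / t ^ 2) / t ^ 2) :=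
    (intervalIntegral.integral_add_adjacent_intervals (hI _ _ (h4p _ (by norm_num)) (h4p _ (by norm_num)))
      (hI _ _ (h4p _ (by norm_num)) hTop)).symm
  have e4 : (∫ t in X * (5/6)..X * (3/2), Real.log (t / (2 * π)) / (2 * π) * (Real.exp (-X ^ 2 / t ^ 2) / t ^ 2)) = (∫ t in X * (5/6)..X * (1), Real.log (t / (2 * π)) / (2 * π) * (Real.exp (-X ^ 2 / t ^ 2) / t ^ 2)) + ∫ t in X * (1)..X * (3/2), Real.log (t / (2 * π)) / (2 * π) * (Real.exp (-X ^ 2 / t ^ 2) / t ^ 2) :=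
    (intervalIntegral.integral_add_adjacent_intervals (hI _ _ (h4p _ (by norm_num)) (h4p _ (by norm_num)))
      (hI _ _ (h4p _ (by norm_num)) hTop)).symm
  have e5 : (∫ t in X * (1)..X * (3/2), Real.log (t / (2 * π)) / (2 * π) * (Real.exp (-X ^ 2 / t ^ 2) / t ^ 2)) = (∫ t in X * (1)..X * (6/5), Real.log (t / (2 * π)) / (2 * π) * (Real.exp (-X ^ 2 / t ^ 2) / t ^ 2)) + ∫ t in X * (6/5)..X * (3/2), Real.log (t / (2 * π)) / (2 * π) * (Real.exp (-X ^ 2 / t ^ 2) / t ^ 2) :=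
    (intervalIntegral.integral_add_adjacent_intervals (hI _ _ (h4p _ (by norm_num)) (h4p _ (by norm_num)))
      (hI _ _ (h4p _ (by norm_num)) hTop)).symm
  have e6 : (∫ t in X * (6/5)..X * (3/2), Real.log (t / (2 * π)) / (2 * π) * (Real.exp (-X ^ 2 / t ^ 2) / t ^ 2)) = (∫ t in X * (6/5)..X * (3/2), Real.log (t / (2 * π)) / (2 * π) * (Real.exp (-X ^ 2 / t ^ 2) / t ^ 2)) + ∫ t in X * (3/2)..X * (3/2), Real.log (t / (2 * π)) / (2 * π) * (Real.exp (-X ^ 2 / t ^ 2) / t ^ 2) :=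
    (intervalIntegral.integral_add_adjacent_intervals (hI _ _ (h4p _ (by norm_num)) (h4p _ (by norm_num)))
      (hI _ _ (h4p _ (by norm_num)) hTop)).symm
  -- piece 0: [1/4, 1/3]
  have hq0 : Real.log (1/3 : ℝ) ≤ (-1) := by
    have h3 : (1:ℝ) < Real.log 3 := by
      rw [← Real.exp_lt_exp, Real.exp_log (by norm_num : (0:ℝ) < 3)]; linarith only [Real.exp_one_lt_d9]
    rw [Real.log_div (by norm_num : (1:ℝ) ≠ 0) (by norm_num : (3:ℝ) ≠ 0), Real.log_one]; linarith only [h3]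
  have hr0 : Real.exp (-1 / (1/3 : ℝ) ^ 2) ≤ 0.001067 := by
    rw [show (-1 : ℝ) / (1/3 : ℝ) ^ 2 = -(9) by norm_num]
    exact exp_neg_le_of_taylor5 (by norm_num) (by norm_num)
  have h0 : (∫ t in X * (1/4)..X * (1/3), Real.log (t / (2 * π)) / (2 * π) * (Real.exp (-X ^ 2 / t ^ 2) / t ^ 2)) ≤ (1067 / 1000000 : ℝ) * (Real.log X / (2 * π * X)) + (-28735377 / 10000000000 : ℝ) * (1 / (2 * π * X)) := by
    have hp := integral_farDensity_piece_le (p := 1/4) (q := 1/3) hX0 (by norm_num) (by norm_num) (h2πp _ (by norm_num))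
    have hqpos : (0:ℝ) < (1/3 : ℝ) := by norm_num
    have hXq : 0 < X * (1/3 : ℝ) := mul_pos hX0 hqpos
    have elog : Real.log (X * (1/3 : ℝ) / (2 * π)) = Real.log X + Real.log (1/3 : ℝ) - Real.log (2 * π) := by
      rw [Real.log_div hXq.ne' h2π0.ne', Real.log_mul hX0.ne' hqpos.ne']
    have hnn : 0 ≤ Real.log X + Real.log (1/3 : ℝ) - Real.log (2 * π) := by
      rw [← elog]
      exact Real.log_nonneg (by rw [le_div_iff₀ h2π0]; linarith only [h2πp (1/3 : ℝ) (by norm_num)])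
    have hd : (0 : ℝ) ≤ (1 / (1/4) - 1 / (1/3)) / X := div_nonneg (by norm_num) hX0.le
    have hw : (Real.log X + Real.log (1/3 : ℝ) - Real.log (2 * π)) / (2 * π) * Real.exp (-1 / (1/3 : ℝ) ^ 2) * ((1 / (1/4) - 1 / (1/3)) / X) ≤
        (Real.log X + (-1) - 1.6931) / (2 * π) * 0.001067 * ((1 / (1/4) - 1 / (1/3)) / X) :=
      mul_le_mul (mul_le_mul (div_le_div_of_nonneg_right (by linarith only [hq0, hL2π]) (by positivity)) hr0 (Real.exp_pos _).le
        (div_nonneg (hnn.trans (by linarith only [hq0, hL2π])) (by positivity))) le_rfl hd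
        (mul_nonneg (div_nonneg (hnn.trans (by linarith only [hq0, hL2π])) (by positivity)) (by norm_num))
    have he : (Real.log X + (-1) - 1.6931) / (2 * π) * 0.001067 * ((1 / (1/4) - 1 / (1/3)) / X) = (1067 / 1000000 : ℝ) * (Real.log X / (2 * π * X)) + (-28735377 / 10000000000 : ℝ) * (1 / (2 * π * X)) := by
      ring
    linarith only [hp, hw, he]
  -- piece 1: [1/3, 1/2]
  have hq1 : Real.log (1/2 : ℝ) ≤ (-0.6931) := by
    rw [Real.log_div (by norm_num : (1:ℝ) ≠ 0) (by norm_num : (2:ℝ) ≠ 0), Real.log_one]; linarith only [Real.log_two_gt_d9]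
  have hr1 : Real.exp (-1 / (1/2 : ℝ) ^ 2) ≤ 0.023329 := by
    rw [show (-1 : ℝ) / (1/2 : ℝ) ^ 2 = -(4) by norm_num]
    exact exp_neg_le_of_taylor5 (by norm_num) (by norm_num)
  have h1 : (∫ t in X * (1/3)..X * (1/2), Real.log (t / (2 * π)) / (2 * π) * (Real.exp (-X ^ 2 / t ^ 2) / t ^ 2)) ≤ (23329 / 1000000 : ℝ) * (Real.log X / (2 * π * X)) + (-278338299 / 5000000000 : ℝ) * (1 / (2 * π * X)) := by
    have hp := integral_farDensity_piece_le (p := 1/3) (q := 1/2) hX0 (by norm_num) (by norm_num) (h2πp _ (by norm_num))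
    have hqpos : (0:ℝ) < (1/2 : ℝ) := by norm_num
    have hXq : 0 < X * (1/2 : ℝ) := mul_pos hX0 hqpos
    have elog : Real.log (X * (1/2 : ℝ) / (2 * π)) = Real.log X + Real.log (1/2 : ℝ) - Real.log (2 * π) := by
      rw [Real.log_div hXq.ne' h2π0.ne', Real.log_mul hX0.ne' hqpos.ne']
    have hnn : 0 ≤ Real.log X + Real.log (1/2 : ℝ) - Real.log (2 * π) := by
      rw [← elog]
      exact Real.log_nonneg (by rw [le_div_iff₀ h2π0]; linarith only [h2πp (1/2 : ℝ) (by norm_num)])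
    have hd : (0 : ℝ) ≤ (1 / (1/3) - 1 / (1/2)) / X := div_nonneg (by norm_num) hX0.le
    have hw : (Real.log X + Real.log (1/2 : ℝ) - Real.log (2 * π)) / (2 * π) * Real.exp (-1 / (1/2 : ℝ) ^ 2) * ((1 / (1/3) - 1 / (1/2)) / X) ≤
        (Real.log X + (-0.6931) - 1.6931) / (2 * π) * 0.023329 * ((1 / (1/3) - 1 / (1/2)) / X) :=
      mul_le_mul (mul_le_mul (div_le_div_of_nonneg_right (by linarith only [hq1, hL2π]) (by positivity)) hr1 (Real.exp_pos _).le
        (div_nonneg (hnn.trans (by linarith only [hq1, hL2π])) (by positivity))) le_rfl hd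
        (mul_nonneg (div_nonneg (hnn.trans (by linarith only [hq1, hL2π])) (by positivity)) (by norm_num))
    have he : (Real.log X + (-0.6931) - 1.6931) / (2 * π) * 0.023329 * ((1 / (1/3) - 1 / (1/2)) / X) = (23329 / 1000000 : ℝ) * (Real.log X / (2 * π * X)) + (-278338299 / 5000000000 : ℝ) * (1 / (2 * π * X)) := by
      ring
    linarith only [hp, hw, he]
  -- piece 2: [1/2, 2/3]
  have hq2 : Real.log (2/3 : ℝ) ≤ (-0.3068) := by
    have h3 : (1:ℝ) < Real.log 3 := by
      rw [← Real.exp_lt_exp, Real.exp_log (by norm_num : (0:ℝ) < 3)]; linarith only [Real.exp_one_lt_d9]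
    rw [Real.log_div (by norm_num : (2:ℝ) ≠ 0) (by norm_num : (3:ℝ) ≠ 0)]; linarith only [h3, Real.log_two_lt_d9]
  have hr2 : Real.exp (-1 / (2/3 : ℝ) ^ 2) ≤ 0.108365 := by
    rw [show (-1 : ℝ) / (2/3 : ℝ) ^ 2 = -(9/4) by norm_num]
    exact exp_neg_le_of_taylor5 (by norm_num) (by norm_num)
  have h2 : (∫ t in X * (1/2)..X * (2/3), Real.log (t / (2 * π)) / (2 * π) * (Real.exp (-X ^ 2 / t ^ 2) / t ^ 2)) ≤ (21673 / 400000 : ℝ) * (Real.log X / (2 * π * X)) + (-433438327 / 4000000000 : ℝ) * (1 / (2 * π * X)) := by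
    have hp := integral_farDensity_piece_le (p := 1/2) (q := 2/3) hX0 (by norm_num) (by norm_num) (h2πp _ (by norm_num))
    have hqpos : (0:ℝ) < (2/3 : ℝ) := by norm_num
    have hXq : 0 < X * (2/3 : ℝ) := mul_pos hX0 hqpos
    have elog : Real.log (X * (2/3 : ℝ) / (2 * π)) = Real.log X + Real.log (2/3 : ℝ) - Real.log (2 * π) := by
      rw [Real.log_div hXq.ne' h2π0.ne', Real.log_mul hX0.ne' hqpos.ne']
    have hnn : 0 ≤ Real.log X + Real.log (2/3 : ℝ) - Real.log (2 * π) := by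
      rw [← elog]
      exact Real.log_nonneg (by rw [le_div_iff₀ h2π0]; linarith only [h2πp (2/3 : ℝ) (by norm_num)])
    have hd : (0 : ℝ) ≤ (1 / (1/2) - 1 / (2/3)) / X := div_nonneg (by norm_num) hX0.le
    have hw : (Real.log X + Real.log (2/3 : ℝ) - Real.log (2 * π)) / (2 * π) * Real.exp (-1 / (2/3 : ℝ) ^ 2) * ((1 / (1/2) - 1 / (2/3)) / X) ≤
        (Real.log X + (-0.3068) - 1.6931) / (2 * π) * 0.108365 * ((1 / (1/2) - 1 / (2/3)) / X) :=
      mul_le_mul (mul_le_mul (div_le_div_of_nonneg_right (by linarith only [hq2, hL2π]) (by positivity)) hr2 (Real.exp_pos _).le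
        (div_nonneg (hnn.trans (by linarith only [hq2, hL2π])) (by positivity))) le_rfl hd
        (mul_nonneg (div_nonneg (hnn.trans (by linarith only [hq2, hL2π])) (by positivity)) (by norm_num))
    have he : (Real.log X + (-0.3068) - 1.6931) / (2 * π) * 0.108365 * ((1 / (1/2) - 1 / (2/3)) / X) = (21673 / 400000 : ℝ) * (Real.log X / (2 * π * X)) + (-433438327 / 4000000000 : ℝ) * (1 / (2 * π * X)) := by
      ring
    linarith only [hp, hw, he]
  -- piece 3: [2/3, 5/6]
  have hq3 : Real.log (5/6 : ℝ) ≤ (-1/6) := by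
    linarith only [Real.log_le_sub_one_of_pos (show (0:ℝ) < 5/6 by norm_num)]
  have hr3 : Real.exp (-1 / (5/6 : ℝ) ^ 2) ≤ 0.237800 := by
    rw [show (-1 : ℝ) / (5/6 : ℝ) ^ 2 = -(36/25) by norm_num]
    exact exp_neg_le_of_taylor5 (by norm_num) (by norm_num)
  have h3 : (∫ t in X * (2/3)..X * (5/6), Real.log (t / (2 * π)) / (2 * π) * (Real.exp (-X ^ 2 / t ^ 2) / t ^ 2)) ≤ (3567 / 50000 : ℝ) * (Real.log X / (2 * π * X)) + (-66337877 / 500000000 : ℝ) * (1 / (2 * π * X)) := by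
    have hp := integral_farDensity_piece_le (p := 2/3) (q := 5/6) hX0 (by norm_num) (by norm_num) (h2πp _ (by norm_num))
    have hqpos : (0:ℝ) < (5/6 : ℝ) := by norm_num
    have hXq : 0 < X * (5/6 : ℝ) := mul_pos hX0 hqpos
    have elog : Real.log (X * (5/6 : ℝ) / (2 * π)) = Real.log X + Real.log (5/6 : ℝ) - Real.log (2 * π) := by
      rw [Real.log_div hXq.ne' h2π0.ne', Real.log_mul hX0.ne' hqpos.ne']
    have hnn : 0 ≤ Real.log X + Real.log (5/6 : ℝ) - Real.log (2 * π) := by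
      rw [← elog]
      exact Real.log_nonneg (by rw [le_div_iff₀ h2π0]; linarith only [h2πp (5/6 : ℝ) (by norm_num)])
    have hd : (0 : ℝ) ≤ (1 / (2/3) - 1 / (5/6)) / X := div_nonneg (by norm_num) hX0.le
    have hw : (Real.log X + Real.log (5/6 : ℝ) - Real.log (2 * π)) / (2 * π) * Real.exp (-1 / (5/6 : ℝ) ^ 2) * ((1 / (2/3) - 1 / (5/6)) / X) ≤
        (Real.log X + (-1/6) - 1.6931) / (2 * π) * 0.237800 * ((1 / (2/3) - 1 / (5/6)) / X) :=
      mul_le_mul (mul_le_mul (div_le_div_of_nonneg_right (by linarith only [hq3, hL2π]) (by positivity)) hr3 (Real.exp_pos _).le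
        (div_nonneg (hnn.trans (by linarith only [hq3, hL2π])) (by positivity))) le_rfl hd
        (mul_nonneg (div_nonneg (hnn.trans (by linarith only [hq3, hL2π])) (by positivity)) (by norm_num))
    have he : (Real.log X + (-1/6) - 1.6931) / (2 * π) * 0.237800 * ((1 / (2/3) - 1 / (5/6)) / X) = (3567 / 50000 : ℝ) * (Real.log X / (2 * π * X)) + (-66337877 / 500000000 : ℝ) * (1 / (2 * π * X)) := by
      ring
    linarith only [hp, hw, he]
  -- piece 4: [5/6, 1]
  have hq4 : Real.log (1 : ℝ) ≤ 0 := by simp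
  have hr4 : Real.exp (-1 / (1 : ℝ) ^ 2) ≤ 0.368099 := by
    rw [show (-1 : ℝ) / (1 : ℝ) ^ 2 = -(1) by norm_num]
    exact exp_neg_le_of_taylor5 (by norm_num) (by norm_num)
  have h4 : (∫ t in X * (5/6)..X * (1), Real.log (t / (2 * π)) / (2 * π) * (Real.exp (-X ^ 2 / t ^ 2) / t ^ 2)) ≤ (368099 / 5000000 : ℝ) * (Real.log X / (2 * π * X)) + (-6232284169 / 50000000000 : ℝ) * (1 / (2 * π * X)) := by
    have hp := integral_farDensity_piece_le (p := 5/6) (q := 1) hX0 (by norm_num) (by norm_num) (h2πp _ (by norm_num))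
    have hqpos : (0:ℝ) < (1 : ℝ) := by norm_num
    have hXq : 0 < X * (1 : ℝ) := mul_pos hX0 hqpos
    have elog : Real.log (X * (1 : ℝ) / (2 * π)) = Real.log X + Real.log (1 : ℝ) - Real.log (2 * π) := by
      rw [Real.log_div hXq.ne' h2π0.ne', Real.log_mul hX0.ne' hqpos.ne']
    have hnn : 0 ≤ Real.log X + Real.log (1 : ℝ) - Real.log (2 * π) := by
      rw [← elog]
      exact Real.log_nonneg (by rw [le_div_iff₀ h2π0]; linarith only [h2πp (1 : ℝ) (by norm_num)])
    have hd : (0 : ℝ) ≤ (1 / (5/6) - 1 / (1)) / X := div_nonneg (by norm_num) hX0.le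
    have hw : (Real.log X + Real.log (1 : ℝ) - Real.log (2 * π)) / (2 * π) * Real.exp (-1 / (1 : ℝ) ^ 2) * ((1 / (5/6) - 1 / (1)) / X) ≤
        (Real.log X + 0 - 1.6931) / (2 * π) * 0.368099 * ((1 / (5/6) - 1 / (1)) / X) :=
      mul_le_mul (mul_le_mul (div_le_div_of_nonneg_right (by linarith only [hq4, hL2π]) (by positivity)) hr4 (Real.exp_pos _).le
        (div_nonneg (hnn.trans (by linarith only [hq4, hL2π])) (by positivity))) le_rfl hd
        (mul_nonneg (div_nonneg (hnn.trans (by linarith only [hq4, hL2π])) (by positivity)) (by norm_num))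
    have he : (Real.log X + 0 - 1.6931) / (2 * π) * 0.368099 * ((1 / (5/6) - 1 / (1)) / X) = (368099 / 5000000 : ℝ) * (Real.log X / (2 * π * X)) + (-6232284169 / 50000000000 : ℝ) * (1 / (2 * π * X)) := by
      ring
    linarith only [hp, hw, he]
  -- piece 5: [1, 6/5]
  have hq5 : Real.log (6/5 : ℝ) ≤ (1/5) := by
    linarith only [Real.log_le_sub_one_of_pos (show (0:ℝ) < 6/5 by norm_num)]
  have hr5 : Real.exp (-1 / (6/5 : ℝ) ^ 2) ≤ 0.499395 := by
    rw [show (-1 : ℝ) / (6/5 : ℝ) ^ 2 = -(25/36) by norm_num]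
    exact exp_neg_le_of_taylor5 (by norm_num) (by norm_num)
  have h5 : (∫ t in X * (1)..X * (6/5), Real.log (t / (2 * π)) / (2 * π) * (Real.exp (-X ^ 2 / t ^ 2) / t ^ 2)) ≤ (33293 / 400000 : ℝ) * (Real.log X / (2 * π * X)) + (-497097783 / 4000000000 : ℝ) * (1 / (2 * π * X)) := by
    have hp := integral_farDensity_piece_le (p := 1) (q := 6/5) hX0 (by norm_num) (by norm_num) (h2πp _ (by norm_num))
    have hqpos : (0:ℝ) < (6/5 : ℝ) := by norm_num
    have hXq : 0 < X * (6/5 : ℝ) := mul_pos hX0 hqpos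
    have elog : Real.log (X * (6/5 : ℝ) / (2 * π)) = Real.log X + Real.log (6/5 : ℝ) - Real.log (2 * π) := by
      rw [Real.log_div hXq.ne' h2π0.ne', Real.log_mul hX0.ne' hqpos.ne']
    have hnn : 0 ≤ Real.log X + Real.log (6/5 : ℝ) - Real.log (2 * π) := by
      rw [← elog]
      exact Real.log_nonneg (by rw [le_div_iff₀ h2π0]; linarith only [h2πp (6/5 : ℝ) (by norm_num)])
    have hd : (0 : ℝ) ≤ (1 / (1) - 1 / (6/5)) / X := div_nonneg (by norm_num) hX0.le
    have hw : (Real.log X + Real.log (6/5 : ℝ) - Real.log (2 * π)) / (2 * π) * Real.exp (-1 / (6/5 : ℝ) ^ 2) * ((1 / (1) - 1 / (6/5)) / X) ≤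
        (Real.log X + (1/5) - 1.6931) / (2 * π) * 0.499395 * ((1 / (1) - 1 / (6/5)) / X) :=
      mul_le_mul (mul_le_mul (div_le_div_of_nonneg_right (by linarith only [hq5, hL2π]) (by positivity)) hr5 (Real.exp_pos _).le
        (div_nonneg (hnn.trans (by linarith only [hq5, hL2π])) (by positivity))) le_rfl hd
        (mul_nonneg (div_nonneg (hnn.trans (by linarith only [hq5, hL2π])) (by positivity)) (by norm_num))
    have he : (Real.log X + (1/5) - 1.6931) / (2 * π) * 0.499395 * ((1 / (1) - 1 / (6/5)) / X) = (33293 / 400000 : ℝ) * (Real.log X / (2 * π * X)) + (-497097783 / 4000000000 : ℝ) * (1 / (2 * π * X)) := by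
      ring
    linarith only [hp, hw, he]
  -- piece 6: [6/5, 3/2]
  have hq6 : Real.log (3/2 : ℝ) ≤ (1/2) := by
    linarith only [Real.log_le_sub_one_of_pos (show (0:ℝ) < 3/2 by norm_num)]
  have hr6 : Real.exp (-1 / (3/2 : ℝ) ^ 2) ≤ 0.641186 := by
    rw [show (-1 : ℝ) / (3/2 : ℝ) ^ 2 = -(4/9) by norm_num]
    exact exp_neg_le_of_taylor5 (by norm_num) (by norm_num)
  have h6 : (∫ t in X * (6/5)..X * (3/2), Real.log (t / (2 * π)) / (2 * π) * (Real.exp (-X ^ 2 / t ^ 2) / t ^ 2)) ≤ (320593 / 3000000 : ℝ) * (Real.log X / (2 * π * X)) + (-1274998361 / 10000000000 : ℝ) * (1 / (2 * π * X)) := by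
    have hp := integral_farDensity_piece_le (p := 6/5) (q := 3/2) hX0 (by norm_num) (by norm_num) (h2πp _ (by norm_num))
    have hqpos : (0:ℝ) < (3/2 : ℝ) := by norm_num
    have hXq : 0 < X * (3/2 : ℝ) := mul_pos hX0 hqpos
    have elog : Real.log (X * (3/2 : ℝ) / (2 * π)) = Real.log X + Real.log (3/2 : ℝ) - Real.log (2 * π) := by
      rw [Real.log_div hXq.ne' h2π0.ne', Real.log_mul hX0.ne' hqpos.ne']
    have hnn : 0 ≤ Real.log X + Real.log (3/2 : ℝ) - Real.log (2 * π) := by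
      rw [← elog]
      exact Real.log_nonneg (by rw [le_div_iff₀ h2π0]; linarith only [h2πp (3/2 : ℝ) (by norm_num)])
    have hd : (0 : ℝ) ≤ (1 / (6/5) - 1 / (3/2)) / X := div_nonneg (by norm_num) hX0.le
    have hw : (Real.log X + Real.log (3/2 : ℝ) - Real.log (2 * π)) / (2 * π) * Real.exp (-1 / (3/2 : ℝ) ^ 2) * ((1 / (6/5) - 1 / (3/2)) / X) ≤
        (Real.log X + (1/2) - 1.6931) / (2 * π) * 0.641186 * ((1 / (6/5) - 1 / (3/2)) / X) :=
      mul_le_mul (mul_le_mul (div_le_div_of_nonneg_right (by linarith only [hq6, hL2π]) (by positivity)) hr6 (Real.exp_pos _).le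
        (div_nonneg (hnn.trans (by linarith only [hq6, hL2π])) (by positivity))) le_rfl hd
        (mul_nonneg (div_nonneg (hnn.trans (by linarith only [hq6, hL2π])) (by positivity)) (by norm_num))
    have he : (Real.log X + (1/2) - 1.6931) / (2 * π) * 0.641186 * ((1 / (6/5) - 1 / (3/2)) / X) = (320593 / 3000000 : ℝ) * (Real.log X / (2 * π * X)) + (-1274998361 / 10000000000 : ℝ) * (1 / (2 * π * X)) := by
      ring
    linarith only [hp, hw, he]
  have hlast : (∫ t in X * (3/2)..X * (3/2), Real.log (t / (2 * π)) / (2 * π) * (Real.exp (-X ^ 2 / t ^ 2) / t ^ 2)) = 0 := intervalIntegral.integral_same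
  -- add up
  linarith only [e0, e1, e2, e3, e4, e5, e6, h0, h1, h2, h3, h4, h5, h6, hlast]

end Summit.RiemannHypothesis.RiemannHypothesis.Theorems.Handoff

end
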